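import Summits.ABC.IUTFork.Repair.RHCellWeightsCreditCertificate
import HarnessLib

/-!
# R-H ROUND 3, the INF-FORM of the credit certificate: PLACE-DEPENDENT slices `J(v_ℚ)` and certified fractions `θ(v_ℚ)` with per-place kept numerator
# `≥ Ψ·S(l⋇)` at every bad packet ⟹ `K(ω) ≥ Ψ·M` ⟹ the weighted [MU-C] holds at `μ₀ = Ψ`

abc-iut cell, rung LADDER-ABC:A2.RESCUE.H; R-H seat abc-iut-rh2-w-1 (GEN 2; Q1′ WEIGHTS typer, kernel side); sequel of `Repair/RHCellWeightsCreditCertificate.lean`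
(p487265: uniform `J, θ` sufficiency + the sup-form of S1). PROOF-ONLY (0 definitions, 0 `Prop` facts). A genuine datum's slice boundary `j₀(w)` VARIES with the
place (`plan/rescue/R-H/SLICE.md`: `j₀/l⋇ = 4(1+L_w)/H_w`), so the honest certificate is per place: at the bed (any DH pilot datum, realising ideles) a weight `ω`
with licence below `J(v_ℚ) ≤ l⋇` (`ω = 1`) and a certified fraction `θ(v_ℚ)` of each cell's `(j²−1)`-demand above it, at every packet of non-zero place weight, whose
per-place kept numerator satisfies `Ψ·S(l⋇) ≤ S(J(v_ℚ)) + θ(v_ℚ)·(S(l⋇) − S(J(v_ℚ)))`, keeps **`K(ω) ≥ Ψ·M`** (`keptMass_settingPrVolSharp_ge_inf_mul_totalTrivialMass`);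
at a genuine Θ-volume datum with the chosen ideles (`M = T.gap`, p478601) this DISCHARGES abc-iut-rh2-q2-eq's weighted [MU-C]
**`OffSigmaTolerance (1 − Ψ) A T (weightedTrivialMass … ω)`** for every `A ≥ 0` (`offSigmaTolerance_weightedTrivialMass_of_inf_chosen`) — the testers' `Ψ = min_v Ψ_v`
over a datum's bad places, the mirror of p487265's sup-form `Φ = max_v Φ_v`; `θ ≡ 0` recovers p483646's depth certificate with place-dependent `J` (`Ψ = min_v S(j₀(v))/S(l⋇)`).
HONEST FRAMING: arithmetic about OUR typed weights; `ω`, `θ` and the [MU-C] are HYPOTHESIS SHAPES — the theorem says what a CERTIFIED per-place credit law would buy AS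
TYPED and certifies none; nothing here asserts that abc is proved or refuted, or that [IUTchIII] Cor. 3.12 holds or fails at any datum, or takes a side on any author;
typed ≠ proved; computed ≠ proved. [claim: Mochizuki2012, status: disputed] for every IUT locution. [cite: Mochizuki2012, IUTchIII Cor. 3.12 p. 173–174,
Prop. 3.9 (i)–(iii) p. 116–117; IUTchIV Thm. 1.10 Step (v) p. 27–29, Steps (viii)–(x) p. 30–32] [cite: DupuyHilado2025, §3.3, Thm. 3.10.1]
-/

noncomputable section

open Set Function NumberField IsDedekindDomain

namespace Summit.ABC.IUTFork.Repair.RH.CellWeights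

open Summit.ABC.IUTFork.Thm311 Summit.ABC.IUTFork.Thm311.Real Summit.ABC.IUTFork.Cor312 Summit.ABC.IUTFork.Cor312.Setting
  Summit.ABC.IUTFork.Cor312Vol Summit.ABC.IUTFork.Cor312Prov Literature.IUT.LogThetaLattice Literature.IUT.LogVolume
  Literature.IUT.HodgeTheaters Literature.IUT.LogVolume.ThetaData Literature.NumberTheory.DiophantineGeometry.GenEll
  Summit.ABC.IUTFork.Repair.RH.SigmaLicence Summit.ABC.IUTFork.Repair.RH.SigmaStrataEq Summit.ABC.IUTFork.Repair.RH.SigmaMass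
  Summit.ABC.IUTFork.Repair.RH.OffSigma Summit.ABC.IUTFork.Conditional

/-! ## §1. One packet: the inf bound -/

section Place

/-- **THE INF BOUND, one packet**: licence below the slice `J ≤ n`, a certified `θ·(j²−1)` credit above it, and `Ψ·S(n) ≤ S(J) + θ·(S(n) − S(J))` ⟹ the profile keeps
`≥ Ψ·S(n)·h` (p487265 `placeSum_credit_ge_of_quadratic` preceded by the numerator bound; `h ≥ 0`). [folklore] -/
theorem placeSum_credit_ge_inf_of_quadratic {n J : ℕ} (hJ : J ≤ n) (ω : Fin n → ℝ) {θ h Ψ : ℝ} (hh : 0 ≤ h)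
    (hbelow : ∀ i : Fin n, (i : ℕ) + 1 ≤ J → ω i = 1)
    (habove : ∀ i : Fin n, J < (i : ℕ) + 1 → θ * ((((i : ℕ) : ℝ) + 1) ^ 2 - 1) ≤ ω i * ((((i : ℕ) : ℝ) + 1) ^ 2 - 1))
    (hΨ : Ψ * ((n : ℝ) * (n - 1) * (2 * n + 5) / 6) ≤
      (J : ℝ) * (J - 1) * (2 * J + 5) / 6 + θ * ((n : ℝ) * (n - 1) * (2 * n + 5) / 6 - (J : ℝ) * (J - 1) * (2 * J + 5) / 6)) :
    Ψ * ((n : ℝ) * (n - 1) * (2 * n + 5) / 6) * h ≤ ∑ i : Fin n, ω i * (((((i : ℕ) : ℝ) + 1) ^ 2 - 1) * h) :=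
  (mul_le_mul_of_nonneg_right hΨ hh).trans (placeSum_credit_ge_of_quadratic hJ ω hh hbelow habove)

end Place

/-! ## §2. At the bed and at the datum: `K(ω) ≥ Ψ·M` and the weighted [MU-C] at `μ₀ = Ψ` -/

section Bed

variable {F : Type} [Field F] [NumberField F] (X : PilotData F) {logv : PadicLogs F} (hlog : LogvAnalytic logv)
  (M : Type) [Field M] [NumberField M]
  (archPk : ∀ (j : (thetaIndex X).Label) (vQ : (thetaIndex X).VQ), Set ((logShellsDH X logv).Packet j vQ))
  (archSub : ∀ (j : (thetaIndex X).Label) (v : (thetaIndex X).V),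
    Set ((logShellsDH X logv).Packet j ((thetaIndex X).over v)))
  (Ψ : ℤ → ∀ v : (thetaIndex X).V, v ∈ (thetaIndex X).Vbad → Set ((logShellsDH X logv).StarPacket v))
  (act : ℤ → ∀ v : (thetaIndex X).V, v ∈ (thetaIndex X).Vbad →
    (logShellsDH X logv).StarPacket v → Module.End ℚ ((logShellsDH X logv).StarPacket v))
  (Mmod : ℤ → ∀ j : (thetaIndex X).LabelStar, Set ((logShellsDH X logv).GlobalPacket j.1))
  (region : ℤ → ∀ j : (thetaIndex X).LabelStar, FinDivisor M → ∀ vQ : (thetaIndex X).VQ,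
    Set ((logShellsDH X logv).Packet j.1 vQ))
  (n : ℤ) {HT : Type} {LogLink : HT → HT → Type} {IsFull : ∀ {s t : HT}, LogLink s t → Prop}
  (lat : LGPGaussianLogThetaLattice LogLink IsFull)
  {Frd : Type} {IsoF : Frd → Frd → Type} {Ob : Frd → Type} {realify : Frd → Frd} {Strip : Type}
  {IsoS : Strip → Strip → Type} {Mv : ∀ v : (thetaIndex X).V, v ∈ (thetaIndex X).Vbad → Type}
  [∀ v h, Monoid (Mv v h)]
  (sig : GlobalLGPFrobenioidSignature (thetaIndex X).lstar (thetaIndex X).V (· ∈ (thetaIndex X).Vbad)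
    Frd IsoF Ob realify Strip IsoS Mv)
  (split : SplittingMonoids Mv) {ObΔ : Type} {N : ∀ v : (thetaIndex X).V, v ∈ (thetaIndex X).Vbad → Type}
  [∀ v h, Monoid (N v h)] (qData : QPilotData ObΔ N)
  (tq : ∀ (pp : Nat.Primes) (x : (thetaIndex X).Fibre (.inr pp)), haveI : Fact (pp : ℕ).Prime := ⟨pp.2⟩; kOf X pp.1 x)
  (t : ∀ (pp : Nat.Primes) (_ : Fin X.lstar) (x : (thetaIndex X).Fibre (.inr pp)),
    haveI : Fact (pp : ℕ).Prime := ⟨pp.2⟩; kOf X pp.1 x)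
  (htq0 : ∀ pp x, tq pp x ≠ 0)
  (htq1 : ∀ (pp : Nat.Primes) (x : (thetaIndex X).Fibre (.inr pp)),
    haveI : Fact (pp : ℕ).Prime := ⟨pp.2⟩; placeOf X pp.1 x ∉ X.S → ‖tq pp x‖ = 1)
  (ht0 : ∀ pp i x, t pp i x ≠ 0)
  (ht : ∀ (pp : Nat.Primes) (i : Fin X.lstar) (x : (thetaIndex X).Fibre (.inr pp)),
    haveI : Fact (pp : ℕ).Prime := ⟨pp.2⟩
    Real.log ‖t pp i x‖ = -(X.thetaPilot i (placeOf X pp.1 x)) * logNorm F (placeOf X pp.1 x) / localDegree F (placeOf X pp.1 x))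
  (htq : ∀ (pp : Nat.Primes) (x : (thetaIndex X).Fibre (.inr pp)),
    haveI : Fact (pp : ℕ).Prime := ⟨pp.2⟩
    Real.log ‖tq pp x‖ = -(X.qPilot (placeOf X pp.1 x)) * logNorm F (placeOf X pp.1 x) / localDegree F (placeOf X pp.1 x))

include ht0 ht htq in
/-- **THE INF-FORM CERTIFICATE AT THE BED: `Ψ·M ≤ K(ω)`** for a weight `ω` with, at every packet `v_ℚ` of non-zero place weight, licence below a PLACE-DEPENDENT slice
`J(v_ℚ) ≤ l⋇`, a certified fraction `θ(v_ℚ)` of each cell's demand above it, and per-place kept numerator `≥ Ψ·S(l⋇)` (realising ideles; `K(ω) = PN Σᶠ ω·cost`,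
`M = (S(l⋇)/l⋇)·Σᶠ h`, p482743). [claim: Mochizuki2012, status: disputed] -/
theorem keptMass_settingPrVolSharp_ge_inf_mul_totalTrivialMass
    (ω : Fin (thetaIndex X).lstar × (thetaIndex X).VQ → ℝ) {J : (thetaIndex X).VQ → ℕ} (hJ : ∀ vQ, J vQ ≤ X.lstar) {θ : (thetaIndex X).VQ → ℝ}
    (hbelow : ∀ (i : Fin (thetaIndex X).lstar) (vQ : (thetaIndex X).VQ), Sum.elim (fun _ : Unit => (0 : ℝ))
      (fun pp : Nat.Primes => (∑ v ∈ placesOver F pp, X.qPilot v * logNorm F v) / Module.finrank ℚ F) vQ ≠ 0 → (i : ℕ) + 1 ≤ J vQ → ω (i, vQ) = 1)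
    (habove : ∀ (i : Fin (thetaIndex X).lstar) (vQ : (thetaIndex X).VQ), Sum.elim (fun _ : Unit => (0 : ℝ))
      (fun pp : Nat.Primes => (∑ v ∈ placesOver F pp, X.qPilot v * logNorm F v) / Module.finrank ℚ F) vQ ≠ 0 → J vQ < (i : ℕ) + 1 →
        θ vQ * ((((i : ℕ) : ℝ) + 1) ^ 2 - 1) ≤ ω (i, vQ) * ((((i : ℕ) : ℝ) + 1) ^ 2 - 1)) {Ψl : ℝ}
    (hΨ : ∀ vQ : (thetaIndex X).VQ, Sum.elim (fun _ : Unit => (0 : ℝ))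
      (fun pp : Nat.Primes => (∑ v ∈ placesOver F pp, X.qPilot v * logNorm F v) / Module.finrank ℚ F) vQ ≠ 0 →
        Ψl * ((X.lstar : ℝ) * (X.lstar - 1) * (2 * X.lstar + 5) / 6) ≤
          (J vQ : ℝ) * (J vQ - 1) * (2 * J vQ + 5) / 6 +
            θ vQ * ((X.lstar : ℝ) * (X.lstar - 1) * (2 * X.lstar + 5) / 6 - (J vQ : ℝ) * (J vQ - 1) * (2 * J vQ + 5) / 6)) :
    Ψl * totalTrivialMass (settingPrVolSharp X hlog M archPk archSub Ψ act Mmod region n lat sig split qData tq t htq0 htq1) ≤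
      processionNormalized (fun i : Fin (thetaIndex X).lstar => ∑ᶠ vQ : (thetaIndex X).VQ,
        ω (i, vQ) * cellTrivialCost (settingPrVolSharp X hlog M archPk archSub Ψ act Mmod region n lat sig split qData tq t htq0 htq1) (i, vQ)) := by
  have hcost := cellTrivialCost_settingPrVolSharp_eq_sqSubOne_mul_placeWeight X hlog M archPk archSub Ψ act Mmod region n lat sig split qData tq t
    htq0 htq1 ht0 ht htq
  have hhfin := placeWeight_support_finite X hlog M archPk archSub Ψ act Mmod region n lat sig split qData tq t htq0 htq1 htq
  have hsupp : ∀ i : Fin (thetaIndex X).lstar, (Function.support fun vQ : (thetaIndex X).VQ =>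
      ω (i, vQ) * cellTrivialCost (settingPrVolSharp X hlog M archPk archSub Ψ act Mmod region n lat sig split qData tq t htq0 htq1) (i, vQ)).Finite :=
    fun i => hhfin.subset (Function.support_subset_iff'.2 fun vQ hvQ => by
      rw [hcost i vQ, Function.notMem_support.1 hvQ, mul_zero, mul_zero])
  rw [totalTrivialMass_settingPrVolSharp_eq_sqSubOneSum_mul_finsum_placeWeight X hlog M archPk archSub Ψ act Mmod region n lat sig split qData tq t
    htq0 htq1 ht0 ht htq]
  have hLHS : Ψl * ((X.lstar : ℝ) * (X.lstar - 1) * (2 * X.lstar + 5) / 6 *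
        (∑ᶠ vQ : (thetaIndex X).VQ, Sum.elim (fun _ : Unit => (0 : ℝ))
          (fun pp : Nat.Primes => (∑ v ∈ placesOver F pp, X.qPilot v * logNorm F v) / Module.finrank ℚ F) vQ) / X.lstar) =
      (∑ᶠ vQ : (thetaIndex X).VQ, Ψl * ((X.lstar : ℝ) * (X.lstar - 1) * (2 * X.lstar + 5) / 6) *
        Sum.elim (fun _ : Unit => (0 : ℝ))
          (fun pp : Nat.Primes => (∑ v ∈ placesOver F pp, X.qPilot v * logNorm F v) / Module.finrank ℚ F) vQ) / X.lstar := by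
    rw [← mul_finsum]
    ring
  rw [hLHS]
  unfold processionNormalized
  rw [sum_finsum_comm Finset.univ (fun (i : Fin (thetaIndex X).lstar) (vQ : (thetaIndex X).VQ) =>
      ω (i, vQ) * cellTrivialCost (settingPrVolSharp X hlog M archPk archSub Ψ act Mmod region n lat sig split qData tq t htq0 htq1) (i, vQ))
    fun i _ => hsupp i]
  refine div_le_div_of_nonneg_right ?_ (Nat.cast_nonneg _)
  have hF : (Function.support fun vQ : (thetaIndex X).VQ => ∑ i : Fin (thetaIndex X).lstar,
      ω (i, vQ) * cellTrivialCost (settingPrVolSharp X hlog M archPk archSub Ψ act Mmod region n lat sig split qData tq t htq0 htq1) (i, vQ)).Finite :=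
    hhfin.subset (Function.support_subset_iff'.2 fun vQ hvQ => Finset.sum_eq_zero fun i _ => by
      rw [hcost i vQ, Function.notMem_support.1 hvQ, mul_zero, mul_zero])
  have hG : (Function.support fun vQ : (thetaIndex X).VQ => Ψl * ((X.lstar : ℝ) * (X.lstar - 1) * (2 * X.lstar + 5) / 6) *
      Sum.elim (fun _ : Unit => (0 : ℝ))
        (fun pp : Nat.Primes => (∑ v ∈ placesOver F pp, X.qPilot v * logNorm F v) / Module.finrank ℚ F) vQ).Finite :=
    hhfin.subset (Function.support_subset_iff'.2 fun vQ hvQ => by rw [Function.notMem_support.1 hvQ, mul_zero])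
  refine finsum_le_finsum' hG hF fun vQ => ?_
  simp only [hcost]
  by_cases h0 : Sum.elim (fun _ : Unit => (0 : ℝ))
      (fun pp : Nat.Primes => (∑ v ∈ placesOver F pp, X.qPilot v * logNorm F v) / Module.finrank ℚ F) vQ = 0
  · simp only [h0, mul_zero, Finset.sum_const_zero, le_refl]
  · exact placeSum_credit_ge_inf_of_quadratic ((hJ vQ).trans_eq rfl) (fun i => ω (i, vQ)) (placeWeight_nonneg X vQ)
      (fun i hi => hbelow i vQ h0 hi) (fun i hi => habove i vQ h0 hi) (hΨ vQ h0)

end Bed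

section Datum

/-- **THE INF-FORM CERTIFICATE AT THE DATUM**: at the bed of a genuine Θ-volume datum with the chosen ideles, a weight `ω` with licence below a place-dependent slice
`J(v_ℚ) ≤ l⋇`, a certified fraction `θ(v_ℚ)` above it, and per-place kept numerator `≥ Ψ·S(l⋇)` at every packet of non-zero place weight DISCHARGES the weighted [MU-C]
`OffSigmaTolerance (1 − Ψ) A T (weightedTrivialMass … ω)` for every `A ≥ 0` (exponent `1/Ψ` through abc-iut-rh2-q2-eq's door; `Ψ = min_v Ψ_v`; `θ ≡ 0`: place-dependent
depth certificate `Ψ = min_v S(j₀(v))/S(l⋇)`). [claim: Mochizuki2012, status: disputed] -/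
theorem offSigmaTolerance_weightedTrivialMass_of_inf_chosen {P : NFPoint} {l : ℕ} (T : Cor22.ThetaVolumeDatumAt P l) :
    letI := T.instFieldF; letI := T.instNumberFieldF; letI := T.instAlgebraF; letI := T.instFieldK; letI := T.instNumberFieldK; letI := T.instAlgebraK;
        letI := T.instFieldFbar; letI := T.instAlgebraFbar; letI := T.instAlgebraKFbar; letI := T.instIsElliptic;
    ∀ (M : Type) [Field M] [NumberField M]
      (archPk : ∀ (j : (thetaIndex (pilotDataOfK T.D T.K)).Label) (vQ : (thetaIndex (pilotDataOfK T.D T.K)).VQ), Set ((logShellsDH (pilotDataOfK T.D T.K) (analyticLogv T.K)).Packet j vQ))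
      (archSub : ∀ (j : (thetaIndex (pilotDataOfK T.D T.K)).Label) (v : (thetaIndex (pilotDataOfK T.D T.K)).V),
        Set ((logShellsDH (pilotDataOfK T.D T.K) (analyticLogv T.K)).Packet j ((thetaIndex (pilotDataOfK T.D T.K)).over v)))
      (Ψ : ℤ → ∀ v : (thetaIndex (pilotDataOfK T.D T.K)).V, v ∈ (thetaIndex (pilotDataOfK T.D T.K)).Vbad → Set ((logShellsDH (pilotDataOfK T.D T.K) (analyticLogv T.K)).StarPacket v))
      (act : ℤ → ∀ v : (thetaIndex (pilotDataOfK T.D T.K)).V, v ∈ (thetaIndex (pilotDataOfK T.D T.K)).Vbad →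
        (logShellsDH (pilotDataOfK T.D T.K) (analyticLogv T.K)).StarPacket v → Module.End ℚ ((logShellsDH (pilotDataOfK T.D T.K) (analyticLogv T.K)).StarPacket v))
      (Mmod : ℤ → ∀ j : (thetaIndex (pilotDataOfK T.D T.K)).LabelStar, Set ((logShellsDH (pilotDataOfK T.D T.K) (analyticLogv T.K)).GlobalPacket j.1))
      (region : ℤ → ∀ j : (thetaIndex (pilotDataOfK T.D T.K)).LabelStar, FinDivisor M →
        ∀ vQ : (thetaIndex (pilotDataOfK T.D T.K)).VQ, Set ((logShellsDH (pilotDataOfK T.D T.K) (analyticLogv T.K)).Packet j.1 vQ))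
      (n : ℤ) {HT : Type} {LogLink : HT → HT → Type} {IsFull : ∀ {s t : HT}, LogLink s t → Prop} (lat : LGPGaussianLogThetaLattice LogLink IsFull)
      {Frd : Type} {IsoF : Frd → Frd → Type} {Ob : Frd → Type} {realify : Frd → Frd} {Strip : Type} {IsoS : Strip → Strip → Type}
      {Mv : ∀ v : (thetaIndex (pilotDataOfK T.D T.K)).V, v ∈ (thetaIndex (pilotDataOfK T.D T.K)).Vbad → Type} [∀ v h, Monoid (Mv v h)]
      (sig : GlobalLGPFrobenioidSignature (thetaIndex (pilotDataOfK T.D T.K)).lstar (thetaIndex (pilotDataOfK T.D T.K)).V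
        (· ∈ (thetaIndex (pilotDataOfK T.D T.K)).Vbad) Frd IsoF Ob realify Strip IsoS Mv)
      (split : SplittingMonoids Mv) {ObΔ : Type} {N : ∀ v : (thetaIndex (pilotDataOfK T.D T.K)).V, v ∈ (thetaIndex (pilotDataOfK T.D T.K)).Vbad → Type}
      [∀ v h, Monoid (N v h)] (qData : QPilotData ObΔ N)
      (ω : Fin (thetaIndex (pilotDataOfK T.D T.K)).lstar × (thetaIndex (pilotDataOfK T.D T.K)).VQ → ℝ)
      (J : (thetaIndex (pilotDataOfK T.D T.K)).VQ → ℕ) (_ : ∀ vQ, J vQ ≤ (pilotDataOfK T.D T.K).lstar) (θ : (thetaIndex (pilotDataOfK T.D T.K)).VQ → ℝ)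
      (_ : ∀ (i : Fin (thetaIndex (pilotDataOfK T.D T.K)).lstar) (vQ : (thetaIndex (pilotDataOfK T.D T.K)).VQ), Sum.elim (fun _ : Unit => (0 : ℝ))
        (fun pp : Nat.Primes => (∑ v ∈ placesOver T.K pp, (pilotDataOfK T.D T.K).qPilot v * logNorm T.K v) / Module.finrank ℚ T.K) vQ ≠ 0 →
          (i : ℕ) + 1 ≤ J vQ → ω (i, vQ) = 1)
      (_ : ∀ (i : Fin (thetaIndex (pilotDataOfK T.D T.K)).lstar) (vQ : (thetaIndex (pilotDataOfK T.D T.K)).VQ), Sum.elim (fun _ : Unit => (0 : ℝ))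
        (fun pp : Nat.Primes => (∑ v ∈ placesOver T.K pp, (pilotDataOfK T.D T.K).qPilot v * logNorm T.K v) / Module.finrank ℚ T.K) vQ ≠ 0 →
          J vQ < (i : ℕ) + 1 → θ vQ * ((((i : ℕ) : ℝ) + 1) ^ 2 - 1) ≤ ω (i, vQ) * ((((i : ℕ) : ℝ) + 1) ^ 2 - 1))
      (Ψl : ℝ) (_ : ∀ vQ : (thetaIndex (pilotDataOfK T.D T.K)).VQ, Sum.elim (fun _ : Unit => (0 : ℝ))
        (fun pp : Nat.Primes => (∑ v ∈ placesOver T.K pp, (pilotDataOfK T.D T.K).qPilot v * logNorm T.K v) / Module.finrank ℚ T.K) vQ ≠ 0 →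
          Ψl * ((((pilotDataOfK T.D T.K).lstar : ℝ) * ((pilotDataOfK T.D T.K).lstar - 1) * (2 * (pilotDataOfK T.D T.K).lstar + 5) / 6)) ≤
            (J vQ : ℝ) * (J vQ - 1) * (2 * J vQ + 5) / 6 +
              θ vQ * ((((pilotDataOfK T.D T.K).lstar : ℝ) * ((pilotDataOfK T.D T.K).lstar - 1) * (2 * (pilotDataOfK T.D T.K).lstar + 5) / 6) -
                (J vQ : ℝ) * (J vQ - 1) * (2 * J vQ + 5) / 6))
      (A : ℝ), 0 ≤ A → OffSigmaTolerance (1 - Ψl) A T (weightedTrivialMass (settingPrVolSharp (pilotDataOfK T.D T.K) (logvAnalytic_analyticLogv (F := T.K)) M archPk archSub Ψ act Mmod region n lat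
            sig split qData (exists_realising_qIdeles_pilotDataOfK T.D).choose (exists_realising_thetaIdeles_pilotDataOfK T.D).choose
            (exists_realising_qIdeles_pilotDataOfK T.D).choose_spec.1 (exists_realising_qIdeles_pilotDataOfK T.D).choose_spec.2.1) ω) := by
  intro M _ _ archPk archSub Ψ act Mmod region n HT LogLink IsFull lat Frd IsoF Ob realify Strip IsoS Mv _ sig split ObΔ N _ qData ω J hJ θ hbelow habove Ψl
    hΨ A hA
  letI := T.instFieldF; letI := T.instNumberFieldF; letI := T.instAlgebraF; letI := T.instFieldK; letI := T.instNumberFieldK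
  letI := T.instAlgebraK; letI := T.instFieldFbar; letI := T.instAlgebraFbar; letI := T.instAlgebraKFbar; letI := T.instIsElliptic
  have H := bridgeHyps_settingPrVolSharp_of_ideles (pilotDataOfK T.D T.K) (logvAnalytic_analyticLogv (F := T.K)) M archPk archSub Ψ act
    Mmod region n lat sig split qData (exists_realising_thetaIdeles_pilotDataOfK T.D).choose (exists_realising_qIdeles_pilotDataOfK T.D).choose
    (exists_realising_thetaIdeles_pilotDataOfK T.D).choose_spec.1 (exists_realising_thetaIdeles_pilotDataOfK T.D).choose_spec.2.1
    (exists_realising_qIdeles_pilotDataOfK T.D).choose_spec.1 (exists_realising_qIdeles_pilotDataOfK T.D).choose_spec.2.1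
  have hg := totalTrivialMass_chosen_eq_gap T M archPk archSub Ψ act Mmod region n lat sig split qData
  have hkept := keptMass_settingPrVolSharp_ge_inf_mul_totalTrivialMass (pilotDataOfK T.D T.K) (logvAnalytic_analyticLogv (F := T.K))
    M archPk archSub Ψ act Mmod region n lat sig split qData (exists_realising_qIdeles_pilotDataOfK T.D).choose
    (exists_realising_thetaIdeles_pilotDataOfK T.D).choose (exists_realising_qIdeles_pilotDataOfK T.D).choose_spec.1
    (exists_realising_qIdeles_pilotDataOfK T.D).choose_spec.2.1 (exists_realising_thetaIdeles_pilotDataOfK T.D).choose_spec.1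
    (exists_realising_thetaIdeles_pilotDataOfK T.D).choose_spec.2.2 (exists_realising_qIdeles_pilotDataOfK T.D).choose_spec.2.2 ω hJ hbelow habove hΨ
  rw [← weightedTrivialMass_compl_eq] at hkept
  have hsplit := weightedTrivialMass_eq_totalTrivialMass_sub H ω
  rw [hg] at hkept hsplit
  unfold OffSigmaTolerance
  rw [hsplit]
  linarith

end Datum

end Summit.ABC.IUTFork.Repair.RH.CellWeights

end
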